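import Mathlib.NumberTheory.Cyclotomic.CyclotomicCharacter
import Mathlib.RingTheory.RootsOfUnity.AlgebraicallyClosed
import Mathlib.NumberTheory.Padics.PadicNumbers
import Mathlib.NumberTheory.NumberField.Basic
import Mathlib.RingTheory.WittVector.Domain
import Mathlib.FieldTheory.IsAlgClosed.AlgebraicClosure
import Literature.AlgebraicGeometry.Motives.AbelianVariety
import Literature.NumberTheory.GaloisRepresentations.AbsGaloisGroup
import HarnessLib

/-!
# [AbsTopIII] §1, Definition 1.5: Kummer-faithful fields (and Remarks 1.5.1–1.5.4)

Mochizuki, *Topics in Absolute Anabelian Geometry III*, §1, pp. 32–34 of the author's manuscript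
(lit key `paper:url-5493eb38cbb7`; journal pagination not held).

Definition 1.5 (p. 32): "Let `k` be a field of characteristic zero, `k̄` an algebraic closure of
`k` [...]. Then we shall say that `k` is *Kummer-faithful* (respectively, *torally
Kummer-faithful*) if, for every finite extension `k_H ⊆ k̄` of `k` [...] and every semi-abelian
variety (respectively, every torus) `A` over `k_H`, either of the following two equivalent
conditions is satisfied: (a) We have `⋂_{N ≥ 1} N · A(k_H) = {0}` [...]. (b) The associated
Kummer map `A(k_H) → H¹(H, Hom(ℚ/ℤ, A(k̄)))` is an injection."

## How it is typed

* Condition (a) for an abstract commutative group is `DivisibleElementsTrivial` (`⋂_N G^N = 1`,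
  multiplicative notation).  Condition (b) is not typed (it needs the Kummer map of `A`; the
  bracketed equivalence proof on p. 32 is the long exact Kummer sequence).
* TORI.  A torus over `k_H` splits over a finite extension `k' ⊇ k_H`, `T(k_H) ↪ T(k') ≅ (k'^×)^r`,
  and divisibility in `T(k_H)` implies divisibility in `(k'^×)^r`; conversely `𝔾_m` is a torus.
  Hence "torally Kummer-faithful" is EQUIVALENT to: `⋂_N (k'^×)^N = {1}` for every finite
  extension `k'/k` — which is how `IsTorallyKummerFaithful` is defined (pure field theory; this
  is also the criterion the text itself uses, Rmk. 1.5.3 (i) p. 33: "it suffices to show that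
  `⋂_N (k^×)^N = {1}`", and the content of Rmk. 1.5.2, Weil restriction).
* SEMI-ABELIAN VARIETIES.  The tree has abelian varieties as schemes
  (`Literature.AlgebraicGeometry.Motives.AbelianVariety`, with Mordell–Weil groups `A.Points`)
  but no tori or semi-abelian varieties as group schemes.  `IsKummerFaithful` therefore records
  condition (a) for the two extreme cases, tori (exactly, as above) and abelian varieties; it is
  IMPLIED BY the printed condition.
  -- TODO(general form): Def. 1.5 quantifies over all semi-abelian varieties over `k_H`; an
  extension `0 → T → A → B → 0` reduces to the two cases when `B(k_H)` has finite torsion (true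
  over sub-`p`-adic fields), not in general.  Facts below whose HYPOTHESIS is "Kummer-faithful"
  are flagged accordingly in their docstrings.
* "sub-`p`-adic" ([Mzk5] = Mochizuki 1999, Def. 15.4 (i), recalled in Rmk. 1.5.4 (i)): a field
  embeddable in a finitely generated extension of some `ℚ_p` — `IsSubpadic`, a real definition.
-/

noncomputable section

open scoped Classical

namespace Literature.AnabelianGeometry.AbsoluteAnabelian.AbsTopIII

universe u

/-! ### Condition (a) of Definition 1.5 -/

/-- Condition (a) of [AbsTopIII] Def. 1.5 p. 32 for an abstract commutative group `G` (written
multiplicatively): "`⋂_{N ≥ 1} N · A = {0}`", i.e. an element admitting `N`-th roots for every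
`N ≥ 1` is trivial. [cite: MochizukiAbsTopIII2015, Def 1.5 (a) p.32] -/
@[mk_iff] structure DivisibleElementsTrivial (G : Type u) [CommGroup G] : Prop where
  /-- an element divisible by every positive integer is the identity -/
  eq_one_of_forall_exists_pow : ∀ x : G, (∀ n : ℕ, 0 < n → ∃ y : G, y ^ n = x) → x = 1

/-! ### Definition 1.5 -/

/-- `k` is *torally Kummer-faithful* ([AbsTopIII] Def. 1.5 p. 32, the "respectively" clause:
every torus over every finite extension `k_H` of `k` satisfies (a)), typed by the equivalent
field-theoretic condition (splitting of tori / Weil restriction, Rmk. 1.5.2 p. 32, and the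
criterion of Rmk. 1.5.3 (i) p. 33 "it suffices to show that `⋂_N (k^×)^N = {1}`"): `k` has
characteristic zero and `⋂_N (k'^×)^N = {1}` for every finite extension `k'` of `k`.
[cite: MochizukiAbsTopIII2015, Def 1.5 p.32] -/
@[mk_iff] structure IsTorallyKummerFaithful (k : Type u) [Field k] : Prop where
  /-- "Let `k` be a field of characteristic zero" -/
  charZero : CharZero k
  /-- `𝔾_m` over every finite extension satisfies condition (a) -/
  units : ∀ (k' : Type u) [Field k'] [Algebra k k'], Module.Finite k k' →
    DivisibleElementsTrivial k'ˣ

open Literature.AlgebraicGeometry.Motives in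
/-- `k` is *Kummer-faithful* ([AbsTopIII] Def. 1.5 p. 32: every semi-abelian variety `A` over
every finite extension `k_H` of `k` satisfies (a) `⋂_N N · A(k_H) = {0}`), typed by the two cases
the tree can express: tori (`IsTorallyKummerFaithful`, exact) and abelian varieties (the tree's
scheme-theoretic `AbelianVariety k'` and its Mordell–Weil group `A.Points k'`, written
multiplicatively).  This predicate is IMPLIED BY the printed one.
-- TODO(general form): all semi-abelian varieties (no tori / semi-abelian group schemes in the
tree yet). [cite: MochizukiAbsTopIII2015, Def 1.5 p.32] -/
@[mk_iff] structure IsKummerFaithful (k : Type u) [Field k] : Prop where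
  /-- the torus case ("Kummer-faithful ⟹ torally Kummer-faithful", Rmk. 1.5.3 (ii)) -/
  torally : IsTorallyKummerFaithful k
  /-- the abelian-variety case of condition (a) -/
  abelianVariety : ∀ (k' : Type u) [Field k'] [Algebra k k'], Module.Finite k k' →
    ∀ A : AbelianVariety k', DivisibleElementsTrivial (A.Points k')

/-- Rmk. 1.5.3 (ii), first sentence: "It follows immediately from the definitions that
'Kummer-faithful ⟹ torally Kummer-faithful'" (here: by definition).
[cite: MochizukiAbsTopIII2015, Rmk 1.5.3 (ii) p.33] -/
theorem IsKummerFaithful.isTorallyKummerFaithful {k : Type u} [Field k] (h : IsKummerFaithful k) :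
    IsTorallyKummerFaithful k :=
  h.torally

/-! ### Sub-`p`-adic fields (recalled in Remark 1.5.4) -/

/-- `k` is *sub-`p`-adic* for the prime `p` ([Mzk5] Def. 15.4 (i), as recalled in [AbsTopIII]
Rmk. 1.5.4 (i) p. 33 and Thm. 1.9 p. 37): `k` embeds into a finitely generated field extension of
`ℚ_p`. [cite: MochizukiAbsTopIII2015, Rmk 1.5.4 (i) p.33] -/
@[mk_iff] structure IsSubpadicFor (k : Type u) [Field k] (p : ℕ) [Fact p.Prime] : Prop where
  /-- an embedding into a finitely generated extension `L` of `ℚ_p` -/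
  exists_embedding : ∃ (L : Type) (_ : Field L) (_ : Algebra ℚ_[p] L),
    (⊤ : IntermediateField ℚ_[p] L).FG ∧ Nonempty (k →+* L)

/-- `k` is *sub-`p`-adic* "for some prime `p`" ([AbsTopIII] Thm. 1.9 p. 37).
[cite: MochizukiAbsTopIII2015, Thm 1.9 p.37] -/
@[mk_iff] structure IsSubpadic (k : Type u) [Field k] : Prop where
  /-- sub-`p`-adic for some prime `p` -/
  exists_prime : ∃ (p : ℕ) (_ : Fact p.Prime), IsSubpadicFor k p

/-- A *generalized sub-`p`-adic* field ([Mzk8] Def. 4.11, as recalled in [AbsTopIII] Rmk. 1.5.4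
(iv) p. 34): `k` embeds into a finitely generated extension of the fraction field of the ring of
Witt vectors `W(𝔽̄_p)`. [cite: MochizukiAbsTopIII2015, Rmk 1.5.4 (iv) p.34] -/
@[mk_iff] structure IsGeneralizedSubpadicFor (k : Type u) [Field k] (p : ℕ) [Fact p.Prime] :
    Prop where
  /-- an embedding into a finitely generated extension `L` of `Frac W(𝔽̄_p)` -/
  exists_embedding : ∃ (L : Type) (_ : Field L)
    (_ : Algebra (FractionRing (WittVector p (AlgebraicClosure (ZMod p)))) L),
    (⊤ : IntermediateField (FractionRing (WittVector p (AlgebraicClosure (ZMod p)))) L).FG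
      ∧ Nonempty (k →+* L)

/-! ### Remark 1.5.1: the cyclotomic character of a torally Kummer-faithful field -/

/-- The `l`-adic cyclotomic character `χ_l : G_k → ℤ_l^×` of a field `k` ([AbsTopIII] Rmk. 1.5.1
p. 32), assembled from Mathlib's `cyclotomicCharacter` of `k̄ = AlgebraicClosure k` and the
tree's identification `Field.absoluteGaloisGroup.toAlgEquiv`.
[cite: MochizukiAbsTopIII2015, Rmk 1.5.1 p.32] -/
def cyclotomicChar (k : Type u) [Field k] (l : ℕ) [Fact l.Prime] :
    Field.absoluteGaloisGroup k →* ℤ_[l]ˣ :=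
  (cyclotomicCharacter (AlgebraicClosure k) l).comp
    { toFun := fun σ => (Field.absoluteGaloisGroup.toAlgEquiv k σ).toRingEquiv
      map_one' := rfl
      map_mul' := fun _ _ => rfl }

/-- Rmk. 1.5.1: "suppose that `k` is a torally Kummer-faithful field, `l` a prime number. Then
[...] the cyclotomic character `χ_l : G_k → ℤ_l^×` has open image".  NAMED FACT.
[cite: MochizukiAbsTopIII2015, Rmk 1.5.1 p.32] -/
def Rmk_1_5_1 : Prop :=
  ∀ (k : Type u) [Field k], IsTorallyKummerFaithful k → ∀ (l : ℕ) [Fact l.Prime],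
    IsOpen (Set.range (cyclotomicChar k l))

/-- Rmk. 1.5.1, second half: the *power-equivalence* relation on characters `G → ℤ_l^×`,
"`ρ₁ ∼ ρ₂` [...] defined by the condition that `ρ₁^N = ρ₂^N` for some positive integer `N`"
(cf. [AbsTopI] Lemma 4.5 (ii)). [cite: MochizukiAbsTopIII2015, Rmk 1.5.1 p.32] -/
def PowerEquivalent {G : Type u} [Group G] {l : ℕ} [Fact l.Prime] (ρ₁ ρ₂ : G →* ℤ_[l]ˣ) : Prop :=
  ∃ N : ℕ, 0 < N ∧ ∀ g, ρ₁ g ^ N = ρ₂ g ^ N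

/-- Power-equivalence is reflexive. [cite: MochizukiAbsTopIII2015, Rmk 1.5.1 p.32] -/
theorem PowerEquivalent.refl {G : Type u} [Group G] {l : ℕ} [Fact l.Prime] (ρ : G →* ℤ_[l]ˣ) :
    PowerEquivalent ρ ρ :=
  ⟨1, one_pos, fun _ => rfl⟩

/-- Power-equivalence is symmetric. [cite: MochizukiAbsTopIII2015, Rmk 1.5.1 p.32] -/
theorem PowerEquivalent.symm {G : Type u} [Group G] {l : ℕ} [Fact l.Prime] {ρ₁ ρ₂ : G →* ℤ_[l]ˣ}
    (h : PowerEquivalent ρ₁ ρ₂) : PowerEquivalent ρ₂ ρ₁ := by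
  obtain ⟨N, hN, hρ⟩ := h
  exact ⟨N, hN, fun g => (hρ g).symm⟩

/-- Power-equivalence is transitive ("it makes sense to speak of the power-equivalence class of
`χ_l`"). [cite: MochizukiAbsTopIII2015, Rmk 1.5.1 p.32] -/
theorem PowerEquivalent.trans {G : Type u} [Group G] {l : ℕ} [Fact l.Prime]
    {ρ₁ ρ₂ ρ₃ : G →* ℤ_[l]ˣ} (h₁ : PowerEquivalent ρ₁ ρ₂) (h₂ : PowerEquivalent ρ₂ ρ₃) :
    PowerEquivalent ρ₁ ρ₃ := by
  obtain ⟨N, hN, hρ⟩ := h₁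
  obtain ⟨M, hM, hρ'⟩ := h₂
  refine ⟨N * M, Nat.mul_pos hN hM, fun g => ?_⟩
  rw [pow_mul, pow_mul, hρ g, ← pow_mul, ← pow_mul, mul_comm N M, pow_mul, pow_mul, hρ' g]

/-! ### Remark 1.5.3 -/

/-- Rmk. 1.5.3 (i), SPECIAL CASE `k` a number field: "`k` is torally Kummer-faithful" (the printed
claim covers any algebraic extension of a number field admitting a nonarchimedean prime unramified
over a number field inside it and with `μ(k†)` finite for all finite `k†/k`; a number field
satisfies these hypotheses trivially).  NAMED FACT.
-- TODO(general form): infinite algebraic extensions of number fields as printed.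
[cite: MochizukiAbsTopIII2015, Rmk 1.5.3 (i) p.33] -/
def Rmk_1_5_3_i : Prop :=
  ∀ (k : Type) [Field k] [NumberField k], IsTorallyKummerFaithful k

/-- Rmk. 1.5.3 (ii): "one may construct an example of a field which is torally Kummer-faithful,
but not Kummer-faithful" (Tamagawa's example: the field cut out by a rank-one summand of the
`p`-adic Tate module of a CM elliptic curve with good reduction everywhere over a number field,
`p ≡ 1 mod 4`; the Kummer map on `E(k)` is not injective).  NAMED FACT (existence form; with the
present `IsKummerFaithful` the failure is in the abelian-variety clause, as printed).
[cite: MochizukiAbsTopIII2015, Rmk 1.5.3 (ii) p.33] -/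
def Rmk_1_5_3_ii : Prop :=
  ∃ (k : Type) (_ : Field k), IsTorallyKummerFaithful k ∧ ¬ IsKummerFaithful k

/-! ### Remark 1.5.4 -/

/-- Rmk. 1.5.4 (i): "every sub-`p`-adic field `k` [...] is Kummer-faithful, i.e., 'sub-`p`-adic
⟹ Kummer-faithful'".  NAMED FACT (with the present `IsKummerFaithful`, implied by print).
[cite: MochizukiAbsTopIII2015, Rmk 1.5.4 (i) p.33] -/
def Rmk_1_5_4_i : Prop :=
  ∀ (k : Type u) [Field k], IsSubpadic k → IsKummerFaithful k

/-- Rmk. 1.5.4 (ii), torus part: "every finitely generated extension of a [...] torally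
Kummer-faithful field is itself [...] torally Kummer-faithful".  NAMED FACT.
-- TODO(general form): the same for "Kummer-faithful" (semi-abelian varieties).
[cite: MochizukiAbsTopIII2015, Rmk 1.5.4 (ii) p.34] -/
def Rmk_1_5_4_ii : Prop :=
  ∀ (k : Type u) [Field k] (L : Type u) [Field L] [Algebra k L],
    (⊤ : IntermediateField k L).FG → IsTorallyKummerFaithful k → IsTorallyKummerFaithful L

/-- Rmk. 1.5.4 (iii): "if [...] `I` is an infinite set, then the field `k := ℚ_p(x_i)_{i ∈ I}`
[...] constitutes an example of a Kummer-faithful field which is not sub-`p`-adic" — here `k` is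
the fraction field of the polynomial ring `ℚ_p[x_i]_{i ∈ I}`.  NAMED FACT (first conjunct implied
by print, see `IsKummerFaithful`). [cite: MochizukiAbsTopIII2015, Rmk 1.5.4 (iii) p.34] -/
def Rmk_1_5_4_iii : Prop :=
  ∀ (p : ℕ) [Fact p.Prime] (I : Type) [Infinite I],
    IsKummerFaithful (FractionRing (MvPolynomial I ℚ_[p]))
      ∧ ¬ IsSubpadic (FractionRing (MvPolynomial I ℚ_[p]))

/-- Rmk. 1.5.4 (iv): "the generalized sub-`p`-adic fields of [Mzk8], Definition 4.11, are not, in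
general, torally Kummer-faithful" (existence of a counterexample).  NAMED FACT.
[cite: MochizukiAbsTopIII2015, Rmk 1.5.4 (iv) p.34] -/
def Rmk_1_5_4_iv : Prop :=
  ∃ (p : ℕ) (_ : Fact p.Prime) (k : Type) (_ : Field k),
    IsGeneralizedSubpadicFor k p ∧ ¬ IsTorallyKummerFaithful k

end Literature.AnabelianGeometry.AbsoluteAnabelian.AbsTopIII
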